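import Summits.BirchSwinnertonDyer.BirchSwinnertonDyer.Theorems.KimAtThreeDeepLowerSplitGlue
import Summits.BirchSwinnertonDyer.BirchSwinnertonDyer.Theorems.KimAtThreeShallowEqDeepSplitGlueNoStub
import HarnessLib

/-!
# Route `KimAtThreeKolyvagin` (rung W2): the GLUE item `DeepLowerOfParts` (stmt-BirchSwinnertonDyer-19680)
# of the §L tenure split of crux `DeepLowerAtThree` (item 19075) — PROVED

Cell `bsd-addord`, seat `bsd-addord-w2-c2` (gen 4), landing the planner's kernel-checked glue (planner
bsd-addord-plan g16, `HOME/planner/splitW2L/EnvW2L.lean`, rc 0; route rev 7–8, STATUS EDIT-END/W2-rev8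
2026-08-26T13:05:44Z). Theorems only — no definition, no named fact, no `sorry`.

* `deepLowerOfParts_proof : …Theses.KimAtThreeKolyvagin.DeepLowerOfParts` closes the GLUE item 19680 by
  type-match: `KatoStratumSharedParts → DeepLowerAtThreeOffKatoStratum → DeepLowerAtThree`, by destructuring the
  five-part alias (Sakamoto 2024 Thm 4.4 ×2, Gross–Zagier–Kolyvagin, Poitou–Tate, Carayol, the shared PORT″ item
  19560) and applying w2-c2 g3's `KimAtThreeDeepLowerSplitGlue.deepLowerAtThree_of_parts` (p441486).
* Informational (no item): the two NO-STUB seams of the sibling cruxes 19076 / 19077 from the SAME five-part alias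
  (`deepUpperAtThree_of_katoStratumSharedParts`, `shallowEqDeepAtTorsionFree_of_katoStratumSharedParts`, via
  w2-c4's p445255 `KimAtThreeShallowEqDeepSplitGlueNoStub`), and the projection of the six-part alias 19598 onto
  the five-part alias (`katoStratumSharedParts_of_deepUpperSplitSharedParts`).

The content children stay OPEN: 19560 (`KatoKuriharaPortThreeShared`, PORT″ at `t = 0` on the Kato stratum, FLAG
K22-Thm3.13-PORT@3) and 19679 (`DeepLowerAtThreeOffKatoStratum`, the lower off-stratum complement); the four
leaves are PUBLISHED inputs by name. HONEST FRAMING: BSD is not proved by any of this; a closed glue closes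
bookkeeping of rung W2 (`closes rung W2 of BirchSwinnertonDyer` only when every child closes), never summit credit.

References: [Kim2025RefinedTNC] Thm. 1.1; [Sakamoto2024] Thm. 4.4; [MazurRubin2004] Thm. 5.2.12; [Carayol1986];
[MilneADT2006] I Thm. 4.10; planner memo `HOME/planner/SPLIT-DRAFTS-W2-g15.md` §L.
-/

-- the Theorems namespace of a single-conjunct summit repeats the summit name by design (D-0017)
set_option linter.dupNamespace false

noncomputable section

namespace Summit.BirchSwinnertonDyer.BirchSwinnertonDyer.Theorems.KimAtThreeDeepLowerSplitGlueItem

open Summit.BirchSwinnertonDyer.BirchSwinnertonDyer.Theses.KimAtThreeKolyvagin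
  Summit.BirchSwinnertonDyer.BirchSwinnertonDyer.Theorems

/-- **Glue item 19680 `DeepLowerOfParts`, PROVED**: the five no-stub shared parts (alias item 19678) and the lower
off-stratum complement (crux 19679) imply the crux `DeepLowerAtThree` (item 19075) — verbatim the planner's EnvW2L
proof through `KimAtThreeDeepLowerSplitGlue.deepLowerAtThree_of_parts` (optimal-datum-at-conductor reduction, then
the end-of-ports LOWER road on the Kato stratum at a constructed place `v₃ ∣ 3` and generator family `η` / the
complement off it). [cite: Kim2025RefinedTNC, Thm. 1.1] [cite: Sakamoto2024, Thm. 4.4 (p. 926)]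
[cite: MazurRubin2004, Thm. 5.2.12] [cite: Carayol1986] -/
theorem deepLowerOfParts_proof :
    Summit.BirchSwinnertonDyer.BirchSwinnertonDyer.Theses.KimAtThreeKolyvagin.DeepLowerOfParts := by
  rintro ⟨hSak, hGZK, hPT, hlev, hPort⟩ hOff
  exact KimAtThreeDeepLowerSplitGlue.deepLowerAtThree_of_parts hSak hGZK hPT hlev hPort hOff

/-- The no-stub seam of crux 19076 from the five-part alias: `KatoStratumSharedParts →
DeepUpperAtThreeOffKatoStratum → DeepUpperAtThree` (w2-c4's `deepUpperAtThree_of_parts_noStub`, p445255 — the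
stub child 19561 is not consumed). Informational; no item. [cite: Kim2025RefinedTNC, Thm. 1.1]
[cite: MazurRubin2004, Thm. 4.4.1 and Thm. 5.2.12] -/
theorem deepUpperAtThree_of_katoStratumSharedParts (h : KatoStratumSharedParts)
    (hOff : DeepUpperAtThreeOffKatoStratum) : DeepUpperAtThree := by
  obtain ⟨hSak, hGZK, hPT, hlev, hPort⟩ := h
  exact KimAtThreeShallowEqDeepSplitGlueNoStub.deepUpperAtThree_of_parts_noStub hSak hGZK hPT hlev hPort hOff

/-- The no-stub seam of crux 19077 from the five-part alias: `KatoStratumSharedParts →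
ShallowEqDeepOffKatoStratum → ShallowEqDeepAtTorsionFree` (w2-c4's `shallowEqDeepAtTorsionFree_of_parts_noStub`,
p445255). Informational; no item. [cite: Kim2025RefinedTNC, Thm. 1.1] [cite: Kim2022StructureSelmer, Thm. 1.9] -/
theorem shallowEqDeepAtTorsionFree_of_katoStratumSharedParts (h : KatoStratumSharedParts)
    (hOff : ShallowEqDeepOffKatoStratum) : ShallowEqDeepAtTorsionFree := by
  obtain ⟨hSak, hGZK, hPT, hlev, hPort⟩ := h
  exact KimAtThreeShallowEqDeepSplitGlueNoStub.shallowEqDeepAtTorsionFree_of_parts_noStub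
    hSak hGZK hPT hlev hPort hOff

/-- The six-part alias `DeepUpperSplitSharedParts` (item 19598) projects onto the five-part alias
`KatoStratumSharedParts` (item 19678): drop the stub conjunct. [folklore] -/
theorem katoStratumSharedParts_of_deepUpperSplitSharedParts (h : DeepUpperSplitSharedParts) :
    KatoStratumSharedParts :=
  ⟨h.1, h.2.1, h.2.2.1, h.2.2.2.1, h.2.2.2.2.1⟩

end Summit.BirchSwinnertonDyer.BirchSwinnertonDyer.Theorems.KimAtThreeDeepLowerSplitGlueItem

end
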